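import Summits.AtomisticToContinuum.Crystallization.Theorems.PalmUnimodularRigidityLayeredLawsSelectHcpCertificateDefsD
import Summits.AtomisticToContinuum.Crystallization.Theorems.PalmUnimodularRigidityLayeredLawsSelectHcpCertificateDefsC

/-!
# Route `PalmUnimodularRigidity`, crux `LayeredLawsSelectHcp` (stmt-AtomisticToContinuum-9226):
# certificate vocabulary, part E — local chart patterns and chart weights on a label set (lead c3, R3′)

Addendum to `…CertificateDefsC.lean` / `…CertificateDefsD.lean` (line `mtp-prestress-split-ergodic-frame`, lead c3, task R3′).
The zero-mean theorem for directed orbit-sum correctors with BALL-admissible data (`CorrDatum.BallAdmissible n`: the shift lies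
in, and the functional reads only, the graph ball `ballLabels n`) is proved by the chain of part C with the near ball replaced by
an arbitrary finite label set `B`: the Mecke transport surrogate is the iterated Campbell integral (`iterInt`, part C, already
generic in the label list) of a CHART WEIGHT ON `B`.  This reviewed module fixes the two `B`-indexed integrands:

* `IsLocalChartPatternOn B z` — the configuration-free part of `IsLocalChartOn B S z` (part D): root at `0`, injective on `B`,
  ideal unit struts ↔ bonds (`0 < dist ≤ 28/25`) on `B × B`;
* `chartWeightOn B e ψ y z` — `ψ` read on `B` if `z` is a local chart pattern on `B` whose label `e` sits at `−y`, else `0`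
  (cf. `chartWeight` = the case `B = nearBall`);
* the read-backs `isLocalChartOn_iff_pattern` (the anchor, a registered sub-goal of stmt-AtomisticToContinuum-9226:
  `IsLocalChartOn B S z ↔ IsLocalChartPatternOn B z ∧ ∀ u ∈ B, z u ∈ S`), `isLocalChartPatternOn_nearBall_iff`,
  `chartWeightOn_nearBall`.

All definitions carry parameters (route-internal bookkeeping, not literature facts); everything is `[folklore]`; nothing here closes
an item.
-/

noncomputable section

namespace Summit.AtomisticToContinuum.Crystallization.Theorems.PalmUnimodularRigidity.LayeredLawsSelectHcp

open MeasureTheory Set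
open Literature.MathematicalPhysics.StatisticalMechanics Literature.Geometry.DiscreteGeometry

/-! ## Local chart patterns and chart weights on a label set -/

/-- **Local chart pattern on the label set `B`** (configuration-free part of `IsLocalChartOn B`): root at `0`, injective on `B`,
ideal unit struts ↔ bonds on `B × B`.  (`IsLocalChartOn B S z ↔ IsLocalChartPatternOn B z ∧ ∀ u ∈ B, z u ∈ S`.) [folklore] -/
def IsLocalChartPatternOn (B : Finset (ℤ × ℤ × ℤ)) (z : ℤ × ℤ × ℤ → EuclideanSpace ℝ (Fin 3)) : Prop :=
  z 0 = 0 ∧ Set.InjOn z ↑B ∧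
    ∀ u ∈ B, ∀ w ∈ B,
      dist (hcpSite 1 (Real.sqrt (2 / 3)) u) (hcpSite 1 (Real.sqrt (2 / 3)) w) = 1 ↔
        (0 < dist (z u) (z w) ∧ dist (z u) (z w) ≤ 28 / 25)

open Classical in
/-- **Chart weight on the label set `B`**: the integrand of the measurable surrogate — `ψ` read on `B` if `z` is a local chart
pattern on `B` whose label `e` sits at `−y`, else `0`. [folklore] -/
def chartWeightOn (B : Finset (ℤ × ℤ × ℤ)) (e : ℤ × ℤ × ℤ) (ψ : (↥B → EuclideanSpace ℝ (Fin 3)) → ℝ)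
    (y : EuclideanSpace ℝ (Fin 3)) (z : ℤ × ℤ × ℤ → EuclideanSpace ℝ (Fin 3)) : ℝ :=
  if IsLocalChartPatternOn B z ∧ z e = -y then ψ (fun u => z u) else 0

/-! ## Elementary read-backs -/

/-- Anchor (registered sub-goal of stmt-AtomisticToContinuum-9226): a local chart on `B` is a local chart pattern on `B` with
`B`-values in `S`. [folklore] -/
theorem isLocalChartOn_iff_pattern : ∀ (B : Finset (ℤ × ℤ × ℤ)) (S : Set (EuclideanSpace ℝ (Fin 3)))
    (z : ℤ × ℤ × ℤ → EuclideanSpace ℝ (Fin 3)), IsLocalChartOn B S z ↔ IsLocalChartPatternOn B z ∧ ∀ u ∈ B, z u ∈ S := by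
  intro B S z
  unfold IsLocalChartOn IsLocalChartPatternOn
  tauto

/-- On the near ball the local chart patterns are those of part C. [folklore] -/
theorem isLocalChartPatternOn_nearBall_iff (z : ℤ × ℤ × ℤ → EuclideanSpace ℝ (Fin 3)) :
    IsLocalChartPatternOn nearBall z ↔ IsLocalChartPattern z :=
  Iff.rfl

/-- On the near ball the chart weight is that of part C. [folklore] -/
theorem chartWeightOn_nearBall (e : ℤ × ℤ × ℤ) (ψ : (↥nearBall → EuclideanSpace ℝ (Fin 3)) → ℝ)
    (y : EuclideanSpace ℝ (Fin 3)) (z : ℤ × ℤ × ℤ → EuclideanSpace ℝ (Fin 3)) :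
    chartWeightOn nearBall e ψ y z = chartWeight e ψ y z :=
  rfl

/-- Off the local chart patterns on `B` with the label `e` at `−y` the chart weight vanishes. [folklore] -/
theorem chartWeightOn_eq_zero_of_not {B : Finset (ℤ × ℤ × ℤ)} {e : ℤ × ℤ × ℤ}
    {ψ : (↥B → EuclideanSpace ℝ (Fin 3)) → ℝ} {y : EuclideanSpace ℝ (Fin 3)} {z : ℤ × ℤ × ℤ → EuclideanSpace ℝ (Fin 3)}
    (h : ¬(IsLocalChartPatternOn B z ∧ z e = -y)) : chartWeightOn B e ψ y z = 0 := by
  rw [chartWeightOn, if_neg h]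

/-- On a local chart pattern on `B` with the label `e` at `−y` the chart weight reads `ψ` on `B`. [folklore] -/
theorem chartWeightOn_eq_of {B : Finset (ℤ × ℤ × ℤ)} {e : ℤ × ℤ × ℤ}
    {ψ : (↥B → EuclideanSpace ℝ (Fin 3)) → ℝ} {y : EuclideanSpace ℝ (Fin 3)} {z : ℤ × ℤ × ℤ → EuclideanSpace ℝ (Fin 3)}
    (h : IsLocalChartPatternOn B z ∧ z e = -y) : chartWeightOn B e ψ y z = ψ (fun u => z u) := by
  rw [chartWeightOn, if_pos h]

end Summit.AtomisticToContinuum.Crystallization.Theorems.PalmUnimodularRigidity.LayeredLawsSelectHcp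

end
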